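import Summits.QuantumFields.BalabanUV.T4Continuum.Support.NE3CurlStability
import HarnessLib

/-!
# NE7DcurlBaseLipschitz — THE DERIVATIVE OF THE DRESSED CURL IS LIPSCHITZ IN THE BASE CONFIGURATION:
# `‖dcurlAt V′ X Y p′ − dcurlAt V X Y p′‖ ≤ 60·δ·bl₁(X)(p′)·bl₁(Y)(p′)` when the three link variables of the plaquette word differ by at most `δ`
# (the companion of row NE3's `NE3CurlStability.norm_curlAt_vary_sub_le` for `dcurlAt`; an input of the strong expansion remainder of F38's bundle)

Cell `pub-balaban`, rung (B)+1 sub-cell t4, lineage `b2b-balaban-t4-ne7-p1`, generation 70 (CRUX PROVER NE7 #1); memo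
`t4/b2b-balaban-t4-ne7-p1-g70/HUNT-H14-APE-FLAT-SKELETON.md` §7.  File F47 (over row NE3's `NE3CurlStability` (`norm_Ad_sub_Ad_le`, `norm_mul_sub_mul_le`),
`NE3HessContinuity.bondL1At`, `NE3HessBounds.norm_comm_le`).
WHY.  The strong expansion remainder (memo §7) needs, besides F45's two-channel split and F46's cubic-vertex letters, the variation of `dcurlAt` with the
base: (i) for the Taylor tail `d_sA − d_0A − s·𝒬(A) = ∫₀ˢ (dcurlAt_{V_t} A A − dcurlAt_{V_0} A A) dt` (with `hasDerivAt_curlAt_vary_at`), and (ii) for the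
adjacent differences of `dcurlAt_{V_t} A A` at `t > 0` (translation covariance changes the base by the lattice differences of `A`).  THIS FILE proves the
Lipschitz bound for two arbitrary unitary backgrounds whose three link variables on the plaquette word differ by `≤ δ`: along `V_t = Ve^{tX}`,
`δ = e^{|t|α} − 1` (`norm_vary_sub_le_of_sup`); between `e^{tA}` and `e^{tA(·−e_τ)}`, `δ ≲ t·α₁`.
WHAT ([folklore]; 0 def, 0 sorry).  §1 `norm_Ad_comm_sub_le` (type (a): a transported commutator, `≤ 4‖w′−w‖·‖Z‖‖Y‖`), `comm_sub_comm_eq`,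
`norm_Ad_comm_Ad_sub_le` (type (b): a transported commutator with a transported factor, `≤ (4‖w′−w‖ + 4‖u′−u‖)·‖Z‖‖Y‖`), `mul_mul_le_of_le`,
`norm_seven_sub_seven_le` (the seven-term shape of `dcurlAt`).  §2 **`norm_dcurlAt_sub_dcurlAt_le`** — the seven terms of `dcurlAt` are of types (a)∕(b) with
words `V₁`, `V₁V₂`, inner transports `V₂`, `V₂V₃⁻¹`, `V₃⁻¹` (differences `δ, 2δ, δ, 2δ, δ`); coefficients `4 + 8 + 8 + 8 + 8 + 12 + 12 = 60`.
HONEST FRAMING (page 1): matrix-norm bookkeeping; nothing of Bałaban's asserted; NOT (APE), NOT ONE-STEP, NOT NE7; spine 0∕9; finite T⁴ rung (B)+1 — NOT infinite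
volume, NOT mass gap, NOT Clay.  Continuum YM on T⁴ ⇐ BetaPertH ∧ nine spine estimates (0/9 proved); BetaPertH ⇐ (D1) ∧ (D4) ∧ CAP+tail; G-an2-4 gates asym,
D1 and NE2/3/4.
-/

set_option autoImplicit false

open scoped BigOperators Matrix Matrix.Norms.L2Operator
open NormedSpace Finset

namespace Summit.QuantumFields.BalabanUV.T4Continuum.NE7DcurlBaseLipschitz

open Literature.MathematicalPhysics.QuantumFieldTheory.Balaban1983to89
open B7Prop1Explicit B7Prop2Explicit MatrixLog UnitaryModel MatrixNorms
open T4AveragingDeficitWall hiding Site Plane Plaq Bond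
open AveragingDeficitTransport (norm_Ad_of_unitary val_inv_eq_star_of_unitary mem_U1_of_unitary)
open AveragingDeficitPlaqDeriv (vary_isUnitaryCfg)
open NE3HessForm NE3HessBounds NE3HessContinuity
open NE3CurlStability (norm_mul_sub_mul_le norm_Ad_sub_Ad_le norm_vary_sub_le_of_sup)
open T4AveragingDeficitNonAbelian (Ad_sub)

noncomputable section

variable {d : ℕ} {n : Type*} [Fintype n] [DecidableEq n]

/-! ## §1 The two kinds of terms of `dcurlAt` between two unitary backgrounds -/

/-- Type (a): a transported commutator. `‖Ad_{w′}(ZY − YZ) − Ad_w(ZY − YZ)‖ ≤ 4‖w′ − w‖·‖Z‖·‖Y‖`. [folklore] -/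
theorem norm_Ad_comm_sub_le [Nonempty n] {w w' : (Matrix n n ℂ)ˣ} (hw : w ∈ unitaryUnits (Matrix n n ℂ)) (hw' : w' ∈ unitaryUnits (Matrix n n ℂ))
    (Z Y : Matrix n n ℂ) :
    ‖Ad w' (Z * Y - Y * Z) - Ad w (Z * Y - Y * Z)‖ ≤ 4 * ‖(w' : Matrix n n ℂ) - (w : Matrix n n ℂ)‖ * ‖Z‖ * ‖Y‖ := by
  have h := norm_Ad_sub_Ad_le hw hw' (Z * Y - Y * Z)
  have hc : ‖Z * Y - Y * Z‖ ≤ 2 * (‖Z‖ * ‖Y‖) := norm_comm_le Z Y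
  have h0 : 0 ≤ ‖(w' : Matrix n n ℂ) - (w : Matrix n n ℂ)‖ := norm_nonneg _
  nlinarith

omit [DecidableEq n] in
/-- The inner difference: `(Z·P′ − P′·Z) − (Z·P − P·Z) = Z·(P′ − P) − (P′ − P)·Z`. [folklore] -/
theorem comm_sub_comm_eq (Z P P' : Matrix n n ℂ) : (Z * P' - P' * Z) - (Z * P - P * Z) = Z * (P' - P) - (P' - P) * Z := by
  simp only [mul_sub, sub_mul]; abel

/-- Type (b): a transported commutator with a transported second factor.
`‖Ad_{w′}(Z·Ad_{u′}Y − Ad_{u′}Y·Z) − Ad_w(Z·Ad_uY − Ad_uY·Z)‖ ≤ (4‖w′ − w‖ + 4‖u′ − u‖)·‖Z‖·‖Y‖`. [folklore] -/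
theorem norm_Ad_comm_Ad_sub_le [Nonempty n] {w w' u u' : (Matrix n n ℂ)ˣ} (hw : w ∈ unitaryUnits (Matrix n n ℂ))
    (hw' : w' ∈ unitaryUnits (Matrix n n ℂ)) (hu : u ∈ unitaryUnits (Matrix n n ℂ)) (hu' : u' ∈ unitaryUnits (Matrix n n ℂ)) (Z Y : Matrix n n ℂ) :
    ‖Ad w' (Z * Ad u' Y - Ad u' Y * Z) - Ad w (Z * Ad u Y - Ad u Y * Z)‖
      ≤ (4 * ‖(w' : Matrix n n ℂ) - (w : Matrix n n ℂ)‖ + 4 * ‖(u' : Matrix n n ℂ) - (u : Matrix n n ℂ)‖) * ‖Z‖ * ‖Y‖ := by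
  have hsplit : Ad w' (Z * Ad u' Y - Ad u' Y * Z) - Ad w (Z * Ad u Y - Ad u Y * Z)
      = (Ad w' (Z * Ad u' Y - Ad u' Y * Z) - Ad w (Z * Ad u' Y - Ad u' Y * Z))
        + Ad w ((Z * Ad u' Y - Ad u' Y * Z) - (Z * Ad u Y - Ad u Y * Z)) := by
    rw [Ad_sub w (Z * Ad u' Y - Ad u' Y * Z) (Z * Ad u Y - Ad u Y * Z)]
    abel
  have h1 := norm_Ad_sub_Ad_le hw hw' (Z * Ad u' Y - Ad u' Y * Z)
  have hI'n : ‖Z * Ad u' Y - Ad u' Y * Z‖ ≤ 2 * (‖Z‖ * ‖Y‖) := by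
    have := norm_comm_le Z (Ad u' Y); rwa [norm_Ad_of_unitary hu'] at this
  have hA := norm_Ad_sub_Ad_le hu hu' Y
  have h2 : ‖Ad w ((Z * Ad u' Y - Ad u' Y * Z) - (Z * Ad u Y - Ad u Y * Z))‖
      ≤ 2 * (‖Z‖ * (2 * ‖(u' : Matrix n n ℂ) - (u : Matrix n n ℂ)‖ * ‖Y‖)) := by
    rw [norm_Ad_of_unitary hw, comm_sub_comm_eq]
    calc ‖Z * (Ad u' Y - Ad u Y) - (Ad u' Y - Ad u Y) * Z‖ ≤ ‖Z * (Ad u' Y - Ad u Y)‖ + ‖(Ad u' Y - Ad u Y) * Z‖ := norm_sub_le _ _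
      _ ≤ ‖Z‖ * ‖Ad u' Y - Ad u Y‖ + ‖Ad u' Y - Ad u Y‖ * ‖Z‖ := add_le_add (norm_mul_le _ _) (norm_mul_le _ _)
      _ ≤ ‖Z‖ * (2 * ‖(u' : Matrix n n ℂ) - (u : Matrix n n ℂ)‖ * ‖Y‖) + (2 * ‖(u' : Matrix n n ℂ) - (u : Matrix n n ℂ)‖ * ‖Y‖) * ‖Z‖ := by
          gcongr
      _ = 2 * (‖Z‖ * (2 * ‖(u' : Matrix n n ℂ) - (u : Matrix n n ℂ)‖ * ‖Y‖)) := by ring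
  have hw0 : 0 ≤ ‖(w' : Matrix n n ℂ) - (w : Matrix n n ℂ)‖ := norm_nonneg _
  have hZ := norm_nonneg Z
  have hY := norm_nonneg Y
  rw [hsplit]
  calc ‖(Ad w' (Z * Ad u' Y - Ad u' Y * Z) - Ad w (Z * Ad u' Y - Ad u' Y * Z))
        + Ad w ((Z * Ad u' Y - Ad u' Y * Z) - (Z * Ad u Y - Ad u Y * Z))‖
      ≤ ‖Ad w' (Z * Ad u' Y - Ad u' Y * Z) - Ad w (Z * Ad u' Y - Ad u' Y * Z)‖
        + ‖Ad w ((Z * Ad u' Y - Ad u' Y * Z) - (Z * Ad u Y - Ad u Y * Z))‖ := norm_add_le _ _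
    _ ≤ 2 * ‖(w' : Matrix n n ℂ) - (w : Matrix n n ℂ)‖ * (2 * (‖Z‖ * ‖Y‖)) + 2 * (‖Z‖ * (2 * ‖(u' : Matrix n n ℂ) - (u : Matrix n n ℂ)‖ * ‖Y‖)) := by
        refine add_le_add (h1.trans ?_) h2
        exact mul_le_mul_of_nonneg_left hI'n (by positivity)
    _ = (4 * ‖(w' : Matrix n n ℂ) - (w : Matrix n n ℂ)‖ + 4 * ‖(u' : Matrix n n ℂ) - (u : Matrix n n ℂ)‖) * ‖Z‖ * ‖Y‖ := by ring

omit [Fintype n] [DecidableEq n] in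
/-- Bookkeeping: `a ≤ A`, `x·y ≤ P` (all nonnegative) ⟹ `a·x·y ≤ A·P`. [folklore] -/
theorem mul_mul_le_of_le {a A x y P : ℝ} (h0 : 0 ≤ a) (ha : a ≤ A) (hx : 0 ≤ x) (hy : 0 ≤ y) (hxy : x * y ≤ P) : a * x * y ≤ A * P := by
  have h1 : a * (x * y) ≤ A * P := mul_le_mul ha hxy (mul_nonneg hx hy) (h0.trans ha)
  calc a * x * y = a * (x * y) := by ring
    _ ≤ A * P := h1

omit [Fintype n] [DecidableEq n] in
/-- Seven-term bookkeeping in a seminormed group: the shape of `dcurlAt V′ − dcurlAt V`. [folklore] -/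
theorem norm_seven_sub_seven_le {E : Type*} [SeminormedAddCommGroup E] (a₁ a₂ a₃ a₄ a₅ a₆ a₇ b₁ b₂ b₃ b₄ b₅ b₆ b₇ : E) :
    ‖(a₁ + (a₂ + a₃) - (a₄ + a₅) - (a₆ + a₇)) - (b₁ + (b₂ + b₃) - (b₄ + b₅) - (b₆ + b₇))‖
      ≤ ‖a₁ - b₁‖ + ‖a₂ - b₂‖ + ‖a₃ - b₃‖ + ‖a₄ - b₄‖ + ‖a₅ - b₅‖ + ‖a₆ - b₆‖ + ‖a₇ - b₇‖ := by
  have h : (a₁ + (a₂ + a₃) - (a₄ + a₅) - (a₆ + a₇)) - (b₁ + (b₂ + b₃) - (b₄ + b₅) - (b₆ + b₇))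
      = (a₁ - b₁) + (a₂ - b₂) + (a₃ - b₃) - (a₄ - b₄) - (a₅ - b₅) - (a₆ - b₆) - (a₇ - b₇) := by abel
  rw [h]
  have e1 := norm_sub_le ((a₁ - b₁) + (a₂ - b₂) + (a₃ - b₃) - (a₄ - b₄) - (a₅ - b₅) - (a₆ - b₆)) (a₇ - b₇)
  have e2 := norm_sub_le ((a₁ - b₁) + (a₂ - b₂) + (a₃ - b₃) - (a₄ - b₄) - (a₅ - b₅)) (a₆ - b₆)
  have e3 := norm_sub_le ((a₁ - b₁) + (a₂ - b₂) + (a₃ - b₃) - (a₄ - b₄)) (a₅ - b₅)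
  have e4 := norm_sub_le ((a₁ - b₁) + (a₂ - b₂) + (a₃ - b₃)) (a₄ - b₄)
  have e5 := norm_add_le ((a₁ - b₁) + (a₂ - b₂)) (a₃ - b₃)
  have e6 := norm_add_le (a₁ - b₁) (a₂ - b₂)
  linarith

/-! ## §2 `dcurlAt` is Lipschitz in the base configuration -/

/-- **`‖dcurlAt V′ X Y p′ − dcurlAt V X Y p′‖ ≤ 60·δ·bl₁(X)(p′)·bl₁(Y)(p′)`** for unitary `V, V′` whose link variables differ by at most `δ` on the
three links `V(z,μ), V(z+e_μ,ν), V(z+e_ν,μ)` of the plaquette word: the seven transported commutators of `dcurlAt` change by the word bounds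
`δ, 2δ, 2δ, δ` (types (a)∕(b) of §1). [folklore] -/
theorem norm_dcurlAt_sub_dcurlAt_le [Nonempty n] {V V' : Site d → Fin d → (Matrix n n ℂ)ˣ} (hV : IsUnitaryCfg V) (hV' : IsUnitaryCfg V')
    (X Y : Site d → Fin d → Matrix n n ℂ) (z : Site d) (μ ν : Fin d) {δ : ℝ}
    (h1 : ‖((V' z μ : (Matrix n n ℂ)ˣ) : Matrix n n ℂ) - (V z μ : Matrix n n ℂ)‖ ≤ δ)
    (h2 : ‖((V' (z + e μ) ν : (Matrix n n ℂ)ˣ) : Matrix n n ℂ) - (V (z + e μ) ν : Matrix n n ℂ)‖ ≤ δ)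
    (h3 : ‖((V' (z + e ν) μ : (Matrix n n ℂ)ˣ) : Matrix n n ℂ) - (V (z + e ν) μ : Matrix n n ℂ)‖ ≤ δ) :
    ‖dcurlAt V' X Y z μ ν - dcurlAt V X Y z μ ν‖ ≤ 60 * δ * (bondL1At X z μ ν * bondL1At Y z μ ν) := by
  have hδ : 0 ≤ δ := (norm_nonneg _).trans h1
  -- norms ≤ 1
  have hn1 : ∀ x κ, ‖((V' x κ : (Matrix n n ℂ)ˣ) : Matrix n n ℂ)‖ ≤ 1 := fun x κ => (mem_U1_of_unitary (hV' x κ)).1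
  have hn0 : ∀ x κ, ‖((V x κ : (Matrix n n ℂ)ˣ) : Matrix n n ℂ)‖ ≤ 1 := fun x κ => (mem_U1_of_unitary (hV x κ)).1
  have hn0i : ∀ x κ, ‖(((V x κ)⁻¹ : (Matrix n n ℂ)ˣ) : Matrix n n ℂ)‖ ≤ 1 := fun x κ => (mem_U1_of_unitary (hV x κ)).2
  -- inverse link difference
  have h3i : ‖(((V' (z + e ν) μ)⁻¹ : (Matrix n n ℂ)ˣ) : Matrix n n ℂ) - (((V (z + e ν) μ)⁻¹ : (Matrix n n ℂ)ˣ) : Matrix n n ℂ)‖ ≤ δ := by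
    rw [val_inv_eq_star_of_unitary (hV (z + e ν) μ), val_inv_eq_star_of_unitary (hV' (z + e ν) μ), ← star_sub, norm_star]
    exact h3
  -- word differences
  have hw12 : ‖((V' z μ * V' (z + e μ) ν : (Matrix n n ℂ)ˣ) : Matrix n n ℂ) - ((V z μ * V (z + e μ) ν : (Matrix n n ℂ)ˣ) : Matrix n n ℂ)‖ ≤ 2 * δ := by
    rw [Units.val_mul, Units.val_mul]
    have h := (norm_mul_sub_mul_le (hn1 z μ) (hn0 (z + e μ) ν) :
      ‖((V' z μ : (Matrix n n ℂ)ˣ) : Matrix n n ℂ) * ((V' (z + e μ) ν : (Matrix n n ℂ)ˣ) : Matrix n n ℂ)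
        - (V z μ : Matrix n n ℂ) * ((V (z + e μ) ν : (Matrix n n ℂ)ˣ) : Matrix n n ℂ)‖ ≤ _)
    linarith
  have hw23 : ‖((V' (z + e μ) ν * (V' (z + e ν) μ)⁻¹ : (Matrix n n ℂ)ˣ) : Matrix n n ℂ)
      - ((V (z + e μ) ν * (V (z + e ν) μ)⁻¹ : (Matrix n n ℂ)ˣ) : Matrix n n ℂ)‖ ≤ 2 * δ := by
    rw [Units.val_mul, Units.val_mul]
    have h := (norm_mul_sub_mul_le (hn1 (z + e μ) ν) (hn0i (z + e ν) μ) :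
      ‖((V' (z + e μ) ν : (Matrix n n ℂ)ˣ) : Matrix n n ℂ) * (((V' (z + e ν) μ)⁻¹ : (Matrix n n ℂ)ˣ) : Matrix n n ℂ)
        - ((V (z + e μ) ν : (Matrix n n ℂ)ˣ) : Matrix n n ℂ) * (((V (z + e ν) μ)⁻¹ : (Matrix n n ℂ)ˣ) : Matrix n n ℂ)‖ ≤ _)
    linarith
  -- unitarity of the words
  have hu1 : V z μ ∈ unitaryUnits (Matrix n n ℂ) := hV z μ
  have hu1' : V' z μ ∈ unitaryUnits (Matrix n n ℂ) := hV' z μ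
  have hu2 : V (z + e μ) ν ∈ unitaryUnits (Matrix n n ℂ) := hV (z + e μ) ν
  have hu2' : V' (z + e μ) ν ∈ unitaryUnits (Matrix n n ℂ) := hV' (z + e μ) ν
  have hu3i : (V (z + e ν) μ)⁻¹ ∈ unitaryUnits (Matrix n n ℂ) := (unitaryUnits (Matrix n n ℂ)).inv_mem (hV (z + e ν) μ)
  have hu3i' : (V' (z + e ν) μ)⁻¹ ∈ unitaryUnits (Matrix n n ℂ) := (unitaryUnits (Matrix n n ℂ)).inv_mem (hV' (z + e ν) μ)
  have hu12 : V z μ * V (z + e μ) ν ∈ unitaryUnits (Matrix n n ℂ) := (unitaryUnits (Matrix n n ℂ)).mul_mem hu1 hu2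
  have hu12' : V' z μ * V' (z + e μ) ν ∈ unitaryUnits (Matrix n n ℂ) := (unitaryUnits (Matrix n n ℂ)).mul_mem hu1' hu2'
  have hu23 : V (z + e μ) ν * (V (z + e ν) μ)⁻¹ ∈ unitaryUnits (Matrix n n ℂ) := (unitaryUnits (Matrix n n ℂ)).mul_mem hu2 hu3i
  have hu23' : V' (z + e μ) ν * (V' (z + e ν) μ)⁻¹ ∈ unitaryUnits (Matrix n n ℂ) := (unitaryUnits (Matrix n n ℂ)).mul_mem hu2' hu3i'
  -- sizes
  have hx1 := norm_nonneg (X z μ); have hx2 := norm_nonneg (X (z + e μ) ν); have hx3 := norm_nonneg (X (z + e ν) μ); have hx4 := norm_nonneg (X z ν)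
  have hy1 := norm_nonneg (Y z μ); have hy2 := norm_nonneg (Y (z + e μ) ν); have hy3 := norm_nonneg (Y (z + e ν) μ); have hy4 := norm_nonneg (Y z ν)
  have hx23 : ‖X (z + e μ) ν - X (z + e ν) μ‖ ≤ ‖X (z + e μ) ν‖ + ‖X (z + e ν) μ‖ := norm_sub_le _ _
  -- each product of bond norms against `P := bl₁(X)·bl₁(Y)`
  have hBX0 : 0 ≤ bondL1At X z μ ν := by unfold bondL1At; linarith [hx1, hx2, hx3, hx4]
  have hP : ∀ {x y : ℝ}, 0 ≤ y → x ≤ bondL1At X z μ ν → y ≤ bondL1At Y z μ ν → x * y ≤ bondL1At X z μ ν * bondL1At Y z μ ν :=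
    fun hy hx hy' => mul_le_mul hx hy' hy hBX0
  have p11 := hP hy1 (by unfold bondL1At; linarith : ‖X z μ‖ ≤ _) (by unfold bondL1At; linarith : ‖Y z μ‖ ≤ _)
  have p12 := hP hy2 (by unfold bondL1At; linarith : ‖X z μ‖ ≤ _) (by unfold bondL1At; linarith : ‖Y (z + e μ) ν‖ ≤ _)
  have p22 := hP hy2 (by unfold bondL1At; linarith : ‖X (z + e μ) ν‖ ≤ _) (by unfold bondL1At; linarith : ‖Y (z + e μ) ν‖ ≤ _)
  have p13 := hP hy3 (by unfold bondL1At; linarith : ‖X z μ‖ ≤ _) (by unfold bondL1At; linarith : ‖Y (z + e ν) μ‖ ≤ _)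
  have p23 := hP hy3 (by unfold bondL1At; linarith : ‖X (z + e μ) ν‖ ≤ _) (by unfold bondL1At; linarith : ‖Y (z + e ν) μ‖ ≤ _)
  have p14 := hP hy4 (by unfold bondL1At; linarith : ‖X z μ‖ ≤ _) (by unfold bondL1At; linarith : ‖Y z ν‖ ≤ _)
  have p234 := hP hy4 (by unfold bondL1At; linarith [hx23] : ‖X (z + e μ) ν - X (z + e ν) μ‖ ≤ _) (by unfold bondL1At; linarith : ‖Y z ν‖ ≤ _)
  -- the seven term differences
  have hT1 := norm_Ad_comm_sub_le hu1 hu1' (X z μ) (Y z μ)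
  have hT2 := norm_Ad_comm_Ad_sub_le hu1 hu1' hu2 hu2' (X z μ) (Y (z + e μ) ν)
  have hT3 := norm_Ad_comm_sub_le hu12 hu12' (X (z + e μ) ν) (Y (z + e μ) ν)
  have hT4 := norm_Ad_comm_Ad_sub_le hu1 hu1' hu2 hu2' (X z μ) (Y (z + e ν) μ)
  have hT5 := norm_Ad_comm_sub_le hu12 hu12' (X (z + e μ) ν) (Y (z + e ν) μ)
  have hT6 := norm_Ad_comm_Ad_sub_le hu1 hu1' hu23 hu23' (X z μ) (Y z ν)
  have hT7 := norm_Ad_comm_Ad_sub_le hu12 hu12' hu3i hu3i' (X (z + e μ) ν - X (z + e ν) μ) (Y z ν)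
  -- the seven bounds (coefficients, then the term lemmas)
  have a1 : 4 * ‖((V' z μ : (Matrix n n ℂ)ˣ) : Matrix n n ℂ) - (V z μ : Matrix n n ℂ)‖ ≤ 4 * δ := by linarith
  have a2 : 4 * ‖((V' z μ : (Matrix n n ℂ)ˣ) : Matrix n n ℂ) - (V z μ : Matrix n n ℂ)‖ + 4 * ‖((V' (z + e μ) ν : (Matrix n n ℂ)ˣ) : Matrix n n ℂ) - (V (z + e μ) ν : Matrix n n ℂ)‖ ≤ 8 * δ := by linarith
  have a3 : 4 * ‖((V' z μ * V' (z + e μ) ν : (Matrix n n ℂ)ˣ) : Matrix n n ℂ) - ((V z μ * V (z + e μ) ν : (Matrix n n ℂ)ˣ) : Matrix n n ℂ)‖ ≤ 8 * δ := by linarith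
  have a6 : 4 * ‖((V' z μ : (Matrix n n ℂ)ˣ) : Matrix n n ℂ) - (V z μ : Matrix n n ℂ)‖ + 4 * ‖((V' (z + e μ) ν * (V' (z + e ν) μ)⁻¹ : (Matrix n n ℂ)ˣ) : Matrix n n ℂ) - ((V (z + e μ) ν * (V (z + e ν) μ)⁻¹ : (Matrix n n ℂ)ˣ) : Matrix n n ℂ)‖ ≤ 12 * δ := by linarith
  have a7 : 4 * ‖((V' z μ * V' (z + e μ) ν : (Matrix n n ℂ)ˣ) : Matrix n n ℂ) - ((V z μ * V (z + e μ) ν : (Matrix n n ℂ)ˣ) : Matrix n n ℂ)‖ + 4 * ‖(((V' (z + e ν) μ)⁻¹ : (Matrix n n ℂ)ˣ) : Matrix n n ℂ) - (((V (z + e ν) μ)⁻¹ : (Matrix n n ℂ)ˣ) : Matrix n n ℂ)‖ ≤ 12 * δ := by linarith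
  have n1 : 0 ≤ ‖((V' z μ : (Matrix n n ℂ)ˣ) : Matrix n n ℂ) - (V z μ : Matrix n n ℂ)‖ := norm_nonneg _
  have n2 : 0 ≤ ‖((V' (z + e μ) ν : (Matrix n n ℂ)ˣ) : Matrix n n ℂ) - (V (z + e μ) ν : Matrix n n ℂ)‖ := norm_nonneg _
  have n12 : 0 ≤ ‖((V' z μ * V' (z + e μ) ν : (Matrix n n ℂ)ˣ) : Matrix n n ℂ) - ((V z μ * V (z + e μ) ν : (Matrix n n ℂ)ˣ) : Matrix n n ℂ)‖ := norm_nonneg _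
  have n23 : 0 ≤ ‖((V' (z + e μ) ν * (V' (z + e ν) μ)⁻¹ : (Matrix n n ℂ)ˣ) : Matrix n n ℂ) - ((V (z + e μ) ν * (V (z + e ν) μ)⁻¹ : (Matrix n n ℂ)ˣ) : Matrix n n ℂ)‖ := norm_nonneg _
  have n3i : 0 ≤ ‖(((V' (z + e ν) μ)⁻¹ : (Matrix n n ℂ)ˣ) : Matrix n n ℂ) - (((V (z + e ν) μ)⁻¹ : (Matrix n n ℂ)ˣ) : Matrix n n ℂ)‖ := norm_nonneg _
  have z1 : 0 ≤ 4 * ‖((V' z μ : (Matrix n n ℂ)ˣ) : Matrix n n ℂ) - (V z μ : Matrix n n ℂ)‖ := by linarith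
  have z2 : 0 ≤ 4 * ‖((V' z μ : (Matrix n n ℂ)ˣ) : Matrix n n ℂ) - (V z μ : Matrix n n ℂ)‖ + 4 * ‖((V' (z + e μ) ν : (Matrix n n ℂ)ˣ) : Matrix n n ℂ) - (V (z + e μ) ν : Matrix n n ℂ)‖ := by linarith
  have z3 : 0 ≤ 4 * ‖((V' z μ * V' (z + e μ) ν : (Matrix n n ℂ)ˣ) : Matrix n n ℂ) - ((V z μ * V (z + e μ) ν : (Matrix n n ℂ)ˣ) : Matrix n n ℂ)‖ := by linarith
  have z6 : 0 ≤ 4 * ‖((V' z μ : (Matrix n n ℂ)ˣ) : Matrix n n ℂ) - (V z μ : Matrix n n ℂ)‖ + 4 * ‖((V' (z + e μ) ν * (V' (z + e ν) μ)⁻¹ : (Matrix n n ℂ)ˣ) : Matrix n n ℂ) - ((V (z + e μ) ν * (V (z + e ν) μ)⁻¹ : (Matrix n n ℂ)ˣ) : Matrix n n ℂ)‖ := by linarith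
  have z7 : 0 ≤ 4 * ‖((V' z μ * V' (z + e μ) ν : (Matrix n n ℂ)ˣ) : Matrix n n ℂ) - ((V z μ * V (z + e μ) ν : (Matrix n n ℂ)ˣ) : Matrix n n ℂ)‖ + 4 * ‖(((V' (z + e ν) μ)⁻¹ : (Matrix n n ℂ)ˣ) : Matrix n n ℂ) - (((V (z + e ν) μ)⁻¹ : (Matrix n n ℂ)ˣ) : Matrix n n ℂ)‖ := by linarith
  have b1 := hT1.trans (mul_mul_le_of_le z1 a1 hx1 hy1 p11)
  have b2 := hT2.trans (mul_mul_le_of_le z2 a2 hx1 hy2 p12)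
  have b3 := hT3.trans (mul_mul_le_of_le z3 a3 hx2 hy2 p22)
  have b4 := hT4.trans (mul_mul_le_of_le z2 a2 hx1 hy3 p13)
  have b5 := hT5.trans (mul_mul_le_of_le z3 a3 hx2 hy3 p23)
  have b6 := hT6.trans (mul_mul_le_of_le z6 a6 hx1 hy4 p14)
  have b7 := hT7.trans (mul_mul_le_of_le z7 a7 (norm_nonneg _) hy4 p234)
  unfold dcurlAt
  refine (norm_seven_sub_seven_le _ _ _ _ _ _ _ _ _ _ _ _ _ _).trans ?_
  linarith [b1, b2, b3, b4, b5, b6, b7]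

end

end Summit.QuantumFields.BalabanUV.T4Continuum.NE7DcurlBaseLipschitz
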